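import Summits.HodgeConjecture.HodgeConjecture.Theorems.MarkmanPartnerTransportK3Sq2OneCycle
import Summits.HodgeConjecture.HodgeConjecture.Theorems.MarkmanPartnerTransportK3Sq2TypeHodgeOfCycleInducedGenerator

/-!
# Route MarkmanPartnerTransport · crux #5 `LowPicardRealMultiplication` — HC⁴(X) for a marked
# `K3^{[2]}`-type fourfold from ONE algebraic self-correspondence acting irrationally on the `2`-form

Composition of the `X`-side one-cycle engine (`…K3Sq2OneCycle`: one rational type-preserving endomorphism
with an irrational `(2,0)`-eigenvalue generates `End_Hdg(T(X)_ℚ)`, or `ρ(X)` is odd and `X` has complex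
multiplication) with the `X`-side F4 `hodgeConjectureFor_of_cycleInducedGenerator` (prover g7: HC⁴(X) once
`End_Hdg(T(X)_ℚ) = ℚ[t|_T]` for a CYCLE-INDUCED `t`, modulo {Verbitsky–Guan, O'Grady, `QInvAlgebraic`}):

* `hodgeConjectureFor_of_oneCycle` — prime form: `d · m + ρ(X) = 23 ⇒ d` prime, one cycle-induced rational
  Hodge endomorphism `t = [Z]_*` (`Z ∈ A⁴(X × X)`) with `t σ = ev σ`, `ev ∉ ℚ`, and no complex multiplication
  if `ρ(X)` is odd ⟹ HC⁴(X);
* `hodgeConjectureFor_of_oneCycle_natDegree` — degree form (`deg minpoly(ev) = k`, `k·j·m + ρ(X) ≠ 23`);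
* `hodgeConjectureFor_of_oneCycle_of_picard_two` — **at `ρ(X) = 2` (inside crux #5's regime `ρ(X) ≤ 3`) ONE
  algebraic class `Z ∈ A⁴(X × X)` whose action on `H^{2,0}(X)` is irrational gives HC⁴(X)** — no CM clause
  (`21` is odd), no degree clause (`21 = 3 · 7`); `…_of_picard_one` — at `ρ(X) = 1` the same modulo "no CM".

So the open content of crux #5 at `ρ(X) = 2` reads: «some algebraic self-correspondence of `X` acts on the
symplectic form by an irrational number». CONDITIONAL on the displayed named facts {Verbitsky–Guan, O'Grady,
`QInvAlgebraic`} exactly as the `X`-side F4; no definition, no sorry. Prover seat hodge-nonav-19652-p1 (gen 8),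
`--supports stmt-HodgeConjecture-19653`. Nothing here proves the crux or HC.

References: E. Markman, Compos. Math. 160 (2024) Thm. 1.1; M. Varesco, Math. Z. 305 (2023) §2; B. van Geemen,
Michigan Math. J. 56 (2008) Lemma 3.2; Yu. Zarhin, J. reine angew. Math. 341 (1983) Thm. 1.5.1.
-/

noncomputable section

set_option linter.dupNamespace false

open Module CategoryTheory MonoidalCategory Polynomial
open Literature.AlgebraicTopology.SingularHomology Literature.Geometry.Kaehler
open Literature.AlgebraicGeometry Literature.AlgebraicGeometry.Motives Literature.AlgebraicGeometry.HodgeTheory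
open Literature.AlgebraicGeometry.Hyperkaehler Literature.AlgebraicGeometry.Surfaces
open Summit.HodgeConjecture.HodgeConjecture.Theorems.NikulinTwinTransport

namespace Summit.HodgeConjecture.HodgeConjecture.Theorems.MarkmanPartnerTransport.PartnerLattice

/-- `MarkedK3Sq[X, φ, P, z]`: VERBATIM the `let MarkedK3Sq := …` binder of the route declarations of
MarkmanPartnerTransport (clauses (m1)–(m6)). Local notation only. -/
local notation3 (prettyPrint := false) "MarkedK3Sq[" X ", " φ ", " P ", " z "]" =>
  (((IsIntegralClass P ∧ ∀ Q : complexBetti X (2 * 4), IsIntegralClass Q → ∃ n : ℤ, Q = n • P) ∧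
    (∀ c : complexBetti X 2, IsIntegralClass c ↔ ∃ v : K3HilbertIndex → ℤ, φ c = fun i => (v i : ℂ)) ∧
    (∀ a : complexBetti X 2, cupPowTwo a 4 = ((3 : ℂ) * (k3HilbertForm 2 (φ a) (φ a)) ^ 2) • P) ∧
    (IsOfHodgeType 4 X 2 2 0 (LinearEquiv.symm φ z) ∧
      ∀ τ : complexBetti X 2, IsOfHodgeType 4 X 2 2 0 τ → ∃ t : ℂ, τ = t • LinearEquiv.symm φ z) ∧
    (∀ c : complexBetti X 2, IsOfHodgeType 4 X 2 1 1 c ↔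
      (k3HilbertForm 2 (φ c) z = 0 ∧ k3HilbertForm 2 (φ c) (star z) = 0)) ∧
    (k3HilbertForm 2 z z = 0 ∧ 0 < (k3HilbertForm 2 (star z) z).re)))

/-- `CMX[X, φ, z]`: "`X` has complex multiplication" in marking coordinates (as in `…K3Sq2OneCycle`). -/
local notation3 (prettyPrint := false) "CMX[" X ", " φ ", " z "]" =>
  (∃ Ψ : complexBetti X 2 →ₗ[ℂ] complexBetti X 2, (∀ y, IsRationalClass y → IsRationalClass (Ψ y)) ∧
    (∀ y, IsOfHodgeType 4 X 2 1 1 y → IsOfHodgeType 4 X 2 1 1 (Ψ y)) ∧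
    ∃ μ : ℂ, μ.im ≠ 0 ∧ Ψ (LinearEquiv.symm φ z) = μ • LinearEquiv.symm φ z)

variable {X : SchemeOver ℂ} {φ : complexBetti X 2 ≃ₗ[ℂ] (K3HilbertIndex → ℂ)} {P : complexBetti X (2 * 4)}
  {z : K3HilbertIndex → ℂ}

/-- **HC⁴(X) from one cycle, prime form.** A marked smooth projective `K3^{[2]}`-type `X` with `d · m + ρ(X) = 23`
(`d ≥ 2`, `m ≥ 3`) forcing `d` prime, without complex multiplication if `ρ(X)` is odd, carrying ONE algebraic
class `Z ∈ A⁴(X × X)` whose action `t = [Z]_*` on `H²(X)` (rational, type-preserving) has an irrational eigenvalue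
on the symplectic form, satisfies HC⁴(X) — modulo {Verbitsky–Guan, O'Grady, `QInvAlgebraic`} (the `X`-side F4).
[cite: Markman2024, §1.1 Thm. 1.1] [cite: Varesco2023, §2 (p. 8)] [cite: Vangeemen2008, Lemma 3.2] -/
theorem hodgeConjectureFor_of_oneCycle
    (hV : VerbitskyGuan_cohomology_K3HilbertSquareType) (hO : OGrady2008_dualBBFClass_algebraic)
    (hQ : QInvAlgebraic) (hX : IsSmoothProjective 4 X) (hK : IsOfK3HilbertSquareType X) (hM : MarkedK3Sq[X, φ, P, z])
    (hρ : ∀ d m : ℕ, 2 ≤ d → 3 ≤ m → d * m + Module.finrank ℂ ↥(algebraicClasses X 1) = 23 → d.Prime)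
    (hcm : Odd (Module.finrank ℂ ↥(algebraicClasses X 1)) → ¬ CMX[X, φ, z])
    (t : complexBetti X 2 →ₗ[ℂ] complexBetti X 2) (ht_rat : ∀ y, IsRationalClass y → IsRationalClass (t y))
    (ht_typ : ∀ (a b : ℕ) y, IsOfHodgeType 4 X 2 a b y → IsOfHodgeType 4 X 2 a b (t y))
    (ht_cyc : ∃ Z ∈ algebraicClasses (X ⊗ X) 4, ∀ y : complexBetti X 2,
      t y = corrAction complexOrientationFamily hX hX (rfl : 2 + 2 * 4 = 2 + 2 * 4) Z y)
    {ev : ℂ} (ht_ev : t (φ.symm z) = ev • φ.symm z) (hev : ∀ a : ℚ, (a : ℂ) ≠ ev) :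
    HodgeConjectureFor 4 X := by
  rcases generatedBy_or_cm_of_eigenvalue hX hM hρ t ht_rat ht_typ ht_ev hev with hgen | ⟨hodd, hCM⟩
  · exact hodgeConjectureFor_of_cycleInducedGenerator hV hO hQ hX hK hM t ht_rat ht_typ ht_cyc hgen
  · exact absurd hCM (hcm hodd)

/-- **HC⁴(X) from one cycle, degree form** (`deg minpoly_ℚ(ev) = k`, `k · j · m + ρ(X) ≠ 23` for `j ≥ 2`,
`m ≥ 3`). [cite: Markman2024, §1.1 Thm. 1.1] [cite: Varesco2023, §2 (p. 8)] [cite: Vangeemen2008, Lemma 3.2] -/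
theorem hodgeConjectureFor_of_oneCycle_natDegree
    (hV : VerbitskyGuan_cohomology_K3HilbertSquareType) (hO : OGrady2008_dualBBFClass_algebraic)
    (hQ : QInvAlgebraic) (hX : IsSmoothProjective 4 X) (hK : IsOfK3HilbertSquareType X) (hM : MarkedK3Sq[X, φ, P, z])
    {k : ℕ} (hk : ∀ j m : ℕ, 2 ≤ j → 3 ≤ m → k * j * m + Module.finrank ℂ ↥(algebraicClasses X 1) ≠ 23)
    (hcm : Odd (Module.finrank ℂ ↥(algebraicClasses X 1)) → ¬ CMX[X, φ, z])
    (t : complexBetti X 2 →ₗ[ℂ] complexBetti X 2) (ht_rat : ∀ y, IsRationalClass y → IsRationalClass (t y))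
    (ht_typ : ∀ (a b : ℕ) y, IsOfHodgeType 4 X 2 a b y → IsOfHodgeType 4 X 2 a b (t y))
    (ht_cyc : ∃ Z ∈ algebraicClasses (X ⊗ X) 4, ∀ y : complexBetti X 2,
      t y = corrAction complexOrientationFamily hX hX (rfl : 2 + 2 * 4 = 2 + 2 * 4) Z y)
    {ev : ℂ} (ht_ev : t (φ.symm z) = ev • φ.symm z) (hdeg : (minpoly ℚ ev).natDegree = k) :
    HodgeConjectureFor 4 X := by
  rcases generatedBy_or_cm_of_eigenvalue_natDegree hX hM hk t ht_rat ht_typ ht_ev hdeg with hgen | ⟨hodd, hCM⟩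
  · exact hodgeConjectureFor_of_cycleInducedGenerator hV hO hQ hX hK hM t ht_rat ht_typ ht_cyc hgen
  · exact absurd hCM (hcm hodd)

/-- `d · m = 21` with `d ≥ 2`, `m ≥ 3` forces `d ∈ {3, 7}`, prime. [folklore] -/
theorem prime_of_mul_eq_twentyOne {d m : ℕ} (hd : 2 ≤ d) (hm : 3 ≤ m) (h : d * m = 21) : d.Prime := by
  have hd7 : d ≤ 7 := by nlinarith
  interval_cases d <;> first | omega | norm_num

/-- `d · m = 22` with `d ≥ 2`, `m ≥ 3` forces `d = 2`, prime. [folklore] -/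
theorem prime_of_mul_eq_twentyTwo {d m : ℕ} (hd : 2 ≤ d) (hm : 3 ≤ m) (h : d * m = 22) : d.Prime := by
  have hd7 : d ≤ 7 := by nlinarith
  interval_cases d <;> first | omega | norm_num

/-- **At `ρ(X) = 2`, ONE algebraic self-correspondence acting irrationally on the symplectic form gives HC⁴(X)**
(marked smooth projective `K3^{[2]}`-type `X`; `dim T(X) = 21 = 3 · 7` is odd: no complex multiplication, and
`[E:ℚ] ∈ {3, 7}` is prime) — modulo {Verbitsky–Guan, O'Grady, `QInvAlgebraic`}. Inside the regime `ρ(X) ≤ 3`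
of crux #5 `LowPicardRealMultiplication`, whose open content at `ρ(X) = 2` thereby reads: «some algebraic
class on `X × X` acts on `H^{2,0}(X)` by an irrational number». [cite: Markman2024, §1.1 Thm. 1.1]
[cite: Varesco2023, §2 (p. 8)] [cite: Vangeemen2008, Lemma 3.2] [cite: Huybrechts2016K3, Ch. 3 Rem. 3.3.14 (ii)] -/
theorem hodgeConjectureFor_of_oneCycle_of_picard_two
    (hV : VerbitskyGuan_cohomology_K3HilbertSquareType) (hO : OGrady2008_dualBBFClass_algebraic)
    (hQ : QInvAlgebraic) (hX : IsSmoothProjective 4 X) (hK : IsOfK3HilbertSquareType X) (hM : MarkedK3Sq[X, φ, P, z])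
    (hρ2 : Module.finrank ℂ ↥(algebraicClasses X 1) = 2)
    (t : complexBetti X 2 →ₗ[ℂ] complexBetti X 2) (ht_rat : ∀ y, IsRationalClass y → IsRationalClass (t y))
    (ht_typ : ∀ (a b : ℕ) y, IsOfHodgeType 4 X 2 a b y → IsOfHodgeType 4 X 2 a b (t y))
    (ht_cyc : ∃ Z ∈ algebraicClasses (X ⊗ X) 4, ∀ y : complexBetti X 2,
      t y = corrAction complexOrientationFamily hX hX (rfl : 2 + 2 * 4 = 2 + 2 * 4) Z y)
    {ev : ℂ} (ht_ev : t (φ.symm z) = ev • φ.symm z) (hev : ∀ a : ℚ, (a : ℂ) ≠ ev) :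
    HodgeConjectureFor 4 X := by
  refine hodgeConjectureFor_of_oneCycle hV hO hQ hX hK hM (fun d m hd hm h => ?_) (fun hodd => ?_) t ht_rat ht_typ
    ht_cyc ht_ev hev
  · exact prime_of_mul_eq_twentyOne hd hm (by omega)
  · exfalso
    rw [hρ2] at hodd
    exact (by decide : ¬ Odd 2) hodd

/-- **At `ρ(X) = 1`, one algebraic self-correspondence acting irrationally on the symplectic form gives HC⁴(X)
provided `X` has no complex multiplication** (`dim T(X) = 22 = 2 · 11`: `[E:ℚ] = 2`, prime) — modulo
{Verbitsky–Guan, O'Grady, `QInvAlgebraic`}. [cite: Markman2024, §1.1 Thm. 1.1] [cite: Varesco2023, §2 (p. 8)]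
[cite: Vangeemen2008, Lemma 3.2] -/
theorem hodgeConjectureFor_of_oneCycle_of_picard_one
    (hV : VerbitskyGuan_cohomology_K3HilbertSquareType) (hO : OGrady2008_dualBBFClass_algebraic)
    (hQ : QInvAlgebraic) (hX : IsSmoothProjective 4 X) (hK : IsOfK3HilbertSquareType X) (hM : MarkedK3Sq[X, φ, P, z])
    (hρ1 : Module.finrank ℂ ↥(algebraicClasses X 1) = 1) (hcm : ¬ CMX[X, φ, z])
    (t : complexBetti X 2 →ₗ[ℂ] complexBetti X 2) (ht_rat : ∀ y, IsRationalClass y → IsRationalClass (t y))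
    (ht_typ : ∀ (a b : ℕ) y, IsOfHodgeType 4 X 2 a b y → IsOfHodgeType 4 X 2 a b (t y))
    (ht_cyc : ∃ Z ∈ algebraicClasses (X ⊗ X) 4, ∀ y : complexBetti X 2,
      t y = corrAction complexOrientationFamily hX hX (rfl : 2 + 2 * 4 = 2 + 2 * 4) Z y)
    {ev : ℂ} (ht_ev : t (φ.symm z) = ev • φ.symm z) (hev : ∀ a : ℚ, (a : ℂ) ≠ ev) :
    HodgeConjectureFor 4 X :=
  hodgeConjectureFor_of_oneCycle hV hO hQ hX hK hM
    (fun d m hd hm h => prime_of_mul_eq_twentyTwo hd hm (by omega)) (fun _ => hcm) t ht_rat ht_typ ht_cyc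
    ht_ev hev

end Summit.HodgeConjecture.HodgeConjecture.Theorems.MarkmanPartnerTransport.PartnerLattice

end
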